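import Summits.Ventures.HodgeRepro2.T5SU11KernelBracketEdge

/-!
# The Lagrange integrals at the spectral edge: `χ_1` against `φ_{λ₂}` and `χ_λ`

With the mixed bracket at infinity of row 514 (`sinh 2R (χ_1 χ_λ′ − χ_λ χ_1′) → 0`), row 510's Lagrange integrals
are repeated with one parameter at the bottom of the spectrum, `μ₁ = 1·(1 − 2) = −1`:

* **`integral_sphDecay_one_mul_sph`** — `(μ₁ − μ₂) ∫_t^s χ_1 φ_{λ₂} sinh 2r dr = W(s) − W(t)` with
  `W = sinh 2r (φ_{λ₂} χ_1′ − χ_1 φ_{λ₂}′)` (Green's identity of row 472 with source `0`);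
* `integrableOn_sphDecay_mul_sphDecay_one_mul_sinh` — `χ_λ χ_1 sinh 2r` is integrable on `(s, ∞)` (row 496 at the
  rate `1 > 2 − λ`);
* **`integral_sphDecay_mul_sphDecay_one_Ioi`** — `(μ − μ₁) ∫_{(s,∞)} χ_λ χ_1 sinh 2r dr = −W_{χχ}(s)`,
  `W_{χχ} = sinh 2r (χ_1 χ_λ′ − χ_λ χ_1′)`, and its mirror `integral_sphDecay_one_mul_sphDecay_Ioi`.

These feed the kernel resolvent identity at the edge (next row). Nothing is claimed about (N).

Blind lane: Mathlib + the HodgeRepro2 prefix only; no sorry; axioms ⊆ {propext, Classical.choice,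
Quot.sound}.
-/

namespace Summit.Ventures.HodgeRepro2.T5SU11KernelIntegralsEdge

open Filter Topology MeasureTheory intervalIntegral
open scoped Real
open Set (Ioi Ioc Icc Ioo)
open T5SU11Cartan T5SU11SphericalFunction T5SU11SphericalBounds T5SU11SphericalContinuous
  T5SU11SphericalSolutionSpaceAll T5SU11SphericalAsymptotic T5SU11SphericalCfun T5SU11SphericalDecay
  T5SU11SphericalDecayAsymptotic T5SU11SphericalDecayBracket T5SU11ReductionOfOrder T5SU11ReductionOfOrderInfinity
  T5SU11ResolventBoundary T5SU11ResolventIdentity T5SU11GreenIdentityInhomogeneous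
  T5SU11RadialGreenImproperDecaySource T5SU11KernelBracket T5SU11SphericalDecayEdge
  T5SU11SphericalDecayEdgeAsymptotic T5SU11ResolventBoundaryEdge T5SU11KernelBracketEdge

section measure

variable [MeasurableSpace Circle] [BorelSpace Circle]

variable {lam : ℝ} (hlam : 1 < lam)

/-! ### The Lagrange integrals with `χ_1` -/

/-- The radial equation of `χ_1` in the inhomogeneous form with source `0`. -/
theorem sphDecay_one_ode_zero : ∀ t, 0 < t → Real.sinh (2 * t) * sphDecay'' 1 t + 2 * Real.cosh (2 * t) * sphDecay' 1 t
    = 1 * (1 - 2) * Real.sinh (2 * t) * sphDecay 1 t + Real.sinh (2 * t) * (fun _ : ℝ => (0 : ℝ)) t :=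
  fun t ht => by rw [sphDecay_one_ode ht]; ring

/-- **`(μ₁ − μ₂) ∫_t^s χ_1 φ_{λ₂} sinh 2r dr = W(s) − W(t)`**, `W = sinh 2r (φ_{λ₂} χ_1′ − χ_1 φ_{λ₂}′)`, `μ₁ = 1·(1−2)`,
for `0 < t ≤ s`. -/
theorem integral_sphDecay_one_mul_sph (lam₂ : ℝ) {t s : ℝ} (ht : 0 < t) (hts : t ≤ s) :
    (1 * (1 - 2) - lam₂ * (lam₂ - 2)) * ∫ r in t..s, sphDecay 1 r * sph lam₂ (hyp r) * Real.sinh (2 * r)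
      = Real.sinh (2 * s) * (sph lam₂ (hyp s) * sphDecay' 1 s - sphDecay 1 s * deriv (fun t => sph lam₂ (hyp t)) s)
        - Real.sinh (2 * t) * (sph lam₂ (hyp t) * sphDecay' 1 t
          - sphDecay 1 t * deriv (fun t => sph lam₂ (hyp t)) t) := by
  have h := green_identity_inhom (fun r hr => hasDerivAt_sphDecay_one hr) (fun r hr => hasDerivAt_sphDecay' 1 hr)
    sphDecay_one_ode_zero (hφ_sph lam₂) (hφ'_sph lam₂) (hode_sph lam₂) continuousOn_const ht hts
  simp only [zero_mul, intervalIntegral.integral_zero] at h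
  linear_combination h

include hlam in
/-- `χ_λ χ_1 sinh 2r` is integrable on `(s, ∞)` for `s > 0`, `λ > 1`. -/
theorem integrableOn_sphDecay_mul_sphDecay_one_mul_sinh {s : ℝ} (hs : 0 < s) :
    IntegrableOn (fun r => sphDecay lam r * sphDecay 1 r * Real.sinh (2 * r)) (Ioi s) := by
  have hπ := Real.pi_pos
  have hχ : ContinuousOn (sphDecay 1) (Ioi 0) :=
    fun _ hr => (hasDerivAt_sphDecay_one hr).continuousAt.continuousWithinAt
  have hg : ContinuousOn (fun r => sphDecay 1 (max r s)) (Ioi 0) :=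
    hχ.comp (continuous_id.max continuous_const).continuousOn (fun r _ => lt_of_lt_of_le hs (le_max_right r s))
  obtain ⟨r₀, hr₀, hmax⟩ := isCompact_Icc.exists_isMaxOn (Set.nonempty_Icc.mpr (le_max_right 1 s))
    (hχ.mono (fun r hr => lt_of_lt_of_le hs hr.1) : ContinuousOn (sphDecay 1) (Icc s (max 1 s)))
  have hM : ∀ r ∈ Ioc (0 : ℝ) 1, |sphDecay 1 (max r s)| ≤ sphDecay 1 r₀ := by
    intro r hr
    have hmem : max r s ∈ Icc s (max 1 s) := ⟨le_max_right r s, max_le (le_trans hr.2 (le_max_left 1 s)) (le_max_right 1 s)⟩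
    rw [abs_of_pos (sphDecay_one_pos (lt_of_lt_of_le hs (le_max_right r s)))]
    exact (isMaxOn_iff.mp hmax) _ hmem
  have hM0 : 0 ≤ sphDecay 1 r₀ := (sphDecay_one_pos (lt_of_lt_of_le hs hr₀.1)).le
  obtain ⟨T₀, hT₀⟩ := eventually_atTop.mp eventually_sphDecay_one_le
  have hC : ∀ r, max T₀ s ≤ r → |sphDecay 1 (max r s)| ≤ π * Real.exp (-1 * r) := by
    intro r hr
    have hrs : s ≤ r := le_trans (le_max_right _ _) hr
    rw [max_eq_left hrs, abs_of_pos (sphDecay_one_pos (lt_of_lt_of_le hs hrs)), neg_one_mul]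
    exact hT₀ r (le_trans (le_max_left _ _) hr)
  have hI := integrableOn_sphDecay_mul_mul_sinh hlam hg hM hM0 (by linarith : 2 - lam < 1) hC
  refine (hI.mono_set (Set.Ioi_subset_Ioi hs.le)).congr_fun ?_ measurableSet_Ioi
  intro r hr
  simp only
  rw [max_eq_left (le_of_lt hr)]

include hlam in
/-- **`(μ − μ₁) ∫_{(s,∞)} χ_λ χ_1 sinh 2r dr = −W_{χχ}(s)`**, `W_{χχ} = sinh 2r (χ_1 χ_λ′ − χ_λ χ_1′)`, `μ₁ = 1·(1−2)`, for
`s > 0`, `λ > 1`. -/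
theorem integral_sphDecay_mul_sphDecay_one_Ioi {s : ℝ} (hs : 0 < s) :
    (lam * (lam - 2) - 1 * (1 - 2)) * ∫ r in Ioi s, sphDecay lam r * sphDecay 1 r * Real.sinh (2 * r)
      = -(Real.sinh (2 * s) * (sphDecay 1 s * sphDecay' lam s - sphDecay lam s * sphDecay' 1 s)) := by
  set W : ℝ → ℝ := fun r => Real.sinh (2 * r) * (sphDecay 1 r * sphDecay' lam r - sphDecay lam r * sphDecay' 1 r)
    with hW
  have hfin : ∀ R, s ≤ R → (lam * (lam - 2) - 1 * (1 - 2))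
      * ∫ r in s..R, sphDecay lam r * sphDecay 1 r * Real.sinh (2 * r) = W R - W s := by
    intro R hR
    have h := green_identity_inhom (fun r hr => hasDerivAt_sphDecay hlam hr) (fun r hr => hasDerivAt_sphDecay' lam hr)
      (sphDecay_ode_zero hlam) (fun r hr => hasDerivAt_sphDecay_one hr) (fun r hr => hasDerivAt_sphDecay' 1 hr)
      (fun r hr => sphDecay_one_ode hr) continuousOn_const hs hR
    simp only [zero_mul, intervalIntegral.integral_zero] at h
    rw [hW]
    linear_combination h
  have h1 : Tendsto (fun R => (lam * (lam - 2) - 1 * (1 - 2))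
      * ∫ r in s..R, sphDecay lam r * sphDecay 1 r * Real.sinh (2 * r)) atTop
      (𝓝 ((lam * (lam - 2) - 1 * (1 - 2))
        * ∫ r in Ioi s, sphDecay lam r * sphDecay 1 r * Real.sinh (2 * r))) :=
    (intervalIntegral_tendsto_integral_Ioi s (integrableOn_sphDecay_mul_sphDecay_one_mul_sinh hlam hs)
      tendsto_id).const_mul _
  have h2 : Tendsto (fun R => W R - W s) atTop (𝓝 (0 - W s)) :=
    (tendsto_bracket_sphDecay_one hlam).sub tendsto_const_nhds
  have h3 : Tendsto (fun R => (lam * (lam - 2) - 1 * (1 - 2))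
      * ∫ r in s..R, sphDecay lam r * sphDecay 1 r * Real.sinh (2 * r)) atTop (𝓝 (0 - W s)) := by
    refine h2.congr' ?_
    filter_upwards [eventually_ge_atTop s] with R hR
    exact (hfin R hR).symm
  have := tendsto_nhds_unique h1 h3
  rw [this, zero_sub, hW]

include hlam in
/-- The mirror: **`(μ₁ − μ) ∫_{(s,∞)} χ_1 χ_λ sinh 2r dr = −W′(s)`**, `W′ = sinh 2r (χ_λ χ_1′ − χ_1 χ_λ′)`. -/
theorem integral_sphDecay_one_mul_sphDecay_Ioi {s : ℝ} (hs : 0 < s) :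
    (1 * (1 - 2) - lam * (lam - 2)) * ∫ r in Ioi s, sphDecay 1 r * sphDecay lam r * Real.sinh (2 * r)
      = -(Real.sinh (2 * s) * (sphDecay lam s * sphDecay' 1 s - sphDecay 1 s * sphDecay' lam s)) := by
  have h := integral_sphDecay_mul_sphDecay_one_Ioi hlam hs
  have e : ∫ r in Ioi s, sphDecay 1 r * sphDecay lam r * Real.sinh (2 * r)
      = ∫ r in Ioi s, sphDecay lam r * sphDecay 1 r * Real.sinh (2 * r) := by
    apply MeasureTheory.integral_congr_ae
    exact Eventually.of_forall fun r => by simp only; ring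
  rw [e]
  linear_combination -h

end measure

end Summit.Ventures.HodgeRepro2.T5SU11KernelIntegralsEdge
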